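import Mathlib
import Summits.Ventures.HodgeRepro.Tier4.Common.KTypeSpace
import Summits.Ventures.HodgeRepro.Tier4.Common.SettingOfData
import Summits.Ventures.HodgeRepro.Tier4.Common.KTypeProjector
import Summits.Ventures.HodgeRepro.Tier4.Common.ProjectorStability
import Summits.Ventures.HodgeRepro.Tier4.Line1.LocallyCompactGA
import Summits.Ventures.HodgeRepro.Tier4.Line1.SecondCountableGA
import Summits.Ventures.HodgeRepro.Tier4.Line4.MaximalFamilyClosed
import Summits.Ventures.HodgeRepro.Tier4.Line4.ConjSpanLemmas
import Summits.Ventures.HodgeRepro.Tier4.Line4.KTypeOfPeriod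
import Summits.Ventures.HodgeRepro.Tier4.Line4.KTypeOfPeriodPrimed

/-!
# Tier4/Line4/KTypeOfPeriodClosed — C-L4-KTYPE on a CLOSED invariant subspace, the display (δ) discharged by name:
the stability of a closed invariant subspace under the `K`-type projector (typer-2's `kProj_mem_span_of_isClosedSub`)

Blind re-derivation cell `pub-hodge-repro`, Tier 4 «prove the step» (README §9–§10), seat t4-L4-p1 (prover, LINE L4,
gen 3; plan-4's cut C-L4-KTYPE S14010).  Tree path `lean/Summits/Ventures/HodgeRepro/Tier4/Line4/KTypeOfPeriodClosed.lean`.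

WHAT IS PROVED.  `hasKTypeAt_of_period_ne_zero_closed` (and the primed twin): for a CLOSED invariant subspace `V` of
typer-2's `Setting.ofAdelicData` (L1's `IsInvariantSubspace` + `Line4.IsClosedSub`) and `f ∈ V` with `P_χ(f) ≠ 0`, `χ`
matching the weight at `w`, the span of `V` has the `K`-type `(e₊ w, e₋ w)` at `w`: `HasKTypeAt W q w (e₊ w) (e₋ w)
(span ℂ V)`.  From `KTypeOfPeriod.hasKTypeAt_of_period_ne_zero` with `hstab` := `ProjectorStability.kProj_mem_span_of_isClosedSub`
(the section instances `[LocallyCompactSpace (GA W)] [SecondCountableTopology (GA W)]` of that module are L1-p5's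
`locallyCompact_GA` / `secondCountable_GA`).  The measure `ν` on the local torus is any Haar PROBABILITY measure
(`[ν.IsHaarMeasure] [IsProbabilityMeasure ν]` — one notch above KTypeOfPeriod's `[ν.IsMulLeftInvariant]`, as
`kProj_mem_span_of_isClosedSub` needs it; typer-2's `haarProb (localTorusAt W w)` (CompactHaarProbability) is one).  Still
DISPLAYED: the compactness of the local torus (`[CompactSpace (localTorusAt W w)]`), the character identities of
`weightAt` on it (`hχ`, `hχc`, `hu'`), and the right-invariance of `R.μT` (`[R.μT.IsMulRightInvariant]`).
The `_span` forms take `f ∈ span ℂ U` for the closed invariant set `U` (the shape of the wall's `V m := span ℂ (conj '' τ m)`):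
for `U` nonempty `span ℂ U = U` as sets (`ConjSpanLemmas.coe_span_eq_of_isInvariantSubspace`), and for `U = ∅` the
hypothesis `P_χ(f) ≠ 0` is contradictory (`f = 0`, `periodLin` is linear).

Nothing here says anything about the status of the Hodge conjecture for CM abelian varieties, which is NOT proved
(HC_CM is NOT proved by anyone in this repository).
-/

set_option autoImplicit false

noncomputable section

namespace Summit.Ventures.HodgeRepro.Tier4.Line4

open Summit.Ventures.HodgeRepro.Tier4.Common Summit.Ventures.HodgeRepro.Tier4.Line1 MeasureTheory NumberField
open scoped ComplexConjugate

section Closed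

variable {k : Type} [Field k] [NumberField k] (W : PlaneData k) [MeasurableSpace (GA W)] [BorelSpace (GA W)]
  (R : RTFData W) (μ : Measure (GA W)) [μ.IsHaarMeasure] [R.μT.IsHaarMeasure] [R.μT'.IsHaarMeasure]
  (DG : Set (GA W)) (fdG : IsFundamentalDomain (rationalPoints W) DG μ) (compG : IsCompact (closure DG))
  (compT : IsCompact (closure R.DT)) (compT' : IsCompact (closure R.DT'))
  (w : InfinitePlace k) (q : QuadData k) (eP eM : InfinitePlace k → ℤ)

/-- **C-L4-KTYPE on a closed invariant subspace** (`T`-side): `P_χ(f) ≠ 0` for some `f ∈ V` gives the `K`-type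
`(e₊ w, e₋ w)` of `T` at `w` on `span ℂ V`. -/
theorem hasKTypeAt_of_period_ne_zero_closed [R.μT.IsMulRightInvariant] [CompactSpace (localTorusAt W w)]
    (ν : Measure (localTorusAt W w)) [ν.IsHaarMeasure] [IsProbabilityMeasure ν]
    (hu : ∀ a, ‖R.chi a‖ = 1) (hc : Continuous R.chi)
    (hχ : ∀ a ∈ localTorusAt W w, ∀ b ∈ localTorusAt W w,
      weightAt W q w 0 (a * b) ^ eP w * weightAt W q w 1 (a * b) ^ eM w =
        (weightAt W q w 0 a ^ eP w * weightAt W q w 1 a ^ eM w) *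
          (weightAt W q w 0 b ^ eP w * weightAt W q w 1 b ^ eM w))
    (hχc : Continuous fun κ : localTorusAt W w => weightAt W q w 0 κ ^ eP w * weightAt W q w 1 κ ^ eM w)
    (hu' : ∀ κ : localTorusAt W w, ‖weightAt W q w 0 κ ^ eP w * weightAt W q w 1 κ ^ eM w‖ = 1)
    (hmatch : ChiMatchesAt W q w (eP w) (eM w) R.chi)
    {V : Set (GA W → ℂ)} (hV : (Setting.ofAdelicData W R μ DG fdG compG compT compT').IsInvariantSubspace V)
    (hcl : IsClosedSub (Setting.ofAdelicData W R μ DG fdG compG compT compT') V)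
    {f : GA W → ℂ} (hf : f ∈ V) (hP : periodLin W R.μT R.DT R.chi (restrictTo W (torusT W) f) ≠ 0) :
    HasKTypeAt W q w (eP w) (eM w) (Submodule.span ℂ V) := by
  haveI := locallyCompact_GA W
  haveI := secondCountable_GA W
  haveI : FirstCountableTopology (GA W) := inferInstance
  exact hasKTypeAt_of_period_ne_zero W R w q eP eM ν hu hc compT hχ hχc hu' hmatch (hV.cont f hf) (hV.inv f hf)
    (kProj_mem_span_of_isClosedSub (Setting.ofAdelicData W R μ DG fdG compG compT compT') hV hcl
      (localTorusAt W w) ν hχc hχ (fun a ha => hu' ⟨a, ha⟩) hf) hP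

/-- **C-L4-KTYPE on a closed invariant subspace, primed** (`T′`-side). -/
theorem hasKTypeAt'_of_period_ne_zero_closed (g g' : Matrix (Fin 4) (Fin 4) k) [R.μT'.IsMulRightInvariant]
    [CompactSpace (localTorusAt' W w)] (ν : Measure (localTorusAt' W w)) [ν.IsHaarMeasure] [IsProbabilityMeasure ν]
    (hu : ∀ a, ‖R.chi' a‖ = 1) (hc : Continuous R.chi')
    (hχ : ∀ a ∈ localTorusAt' W w, ∀ b ∈ localTorusAt' W w,
      weightAt' W q w g g' 0 (a * b) ^ eP w * weightAt' W q w g g' 1 (a * b) ^ eM w =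
        (weightAt' W q w g g' 0 a ^ eP w * weightAt' W q w g g' 1 a ^ eM w) *
          (weightAt' W q w g g' 0 b ^ eP w * weightAt' W q w g g' 1 b ^ eM w))
    (hχc : Continuous fun κ : localTorusAt' W w =>
      weightAt' W q w g g' 0 κ ^ eP w * weightAt' W q w g g' 1 κ ^ eM w)
    (hu' : ∀ κ : localTorusAt' W w, ‖weightAt' W q w g g' 0 κ ^ eP w * weightAt' W q w g g' 1 κ ^ eM w‖ = 1)
    (hmatch : ChiMatchesAt' W q w g g' (eP w) (eM w) R.chi')
    {V : Set (GA W → ℂ)} (hV : (Setting.ofAdelicData W R μ DG fdG compG compT compT').IsInvariantSubspace V)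
    (hcl : IsClosedSub (Setting.ofAdelicData W R μ DG fdG compG compT compT') V)
    {f : GA W → ℂ} (hf : f ∈ V) (hP : periodLin W R.μT' R.DT' R.chi' (restrictTo W (torusT' W) f) ≠ 0) :
    HasKTypeAt' W q w g g' (eP w) (eM w) (Submodule.span ℂ V) := by
  haveI := locallyCompact_GA W
  haveI := secondCountable_GA W
  haveI : FirstCountableTopology (GA W) := inferInstance
  exact hasKTypeAt'_of_period_ne_zero W R w q g g' eP eM ν hu hc compT' hχ hχc hu' hmatch (hV.cont f hf)
    (hV.inv f hf)
    (kProj_mem_span_of_isClosedSub (Setting.ofAdelicData W R μ DG fdG compG compT compT') hV hcl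
      (localTorusAt' W w) ν hχc hχ (fun a ha => hu' ⟨a, ha⟩) hf) hP

/-- **The `span` form** (`f ∈ span ℂ U`, `U` a closed invariant set): the `K`-type `(e₊ w, e₋ w)` of `T` at `w` on
`span ℂ U` from `P_χ(f) ≠ 0`. -/
theorem hasKTypeAt_of_period_ne_zero_span [R.μT.IsMulRightInvariant] [CompactSpace (localTorusAt W w)]
    (ν : Measure (localTorusAt W w)) [ν.IsHaarMeasure] [IsProbabilityMeasure ν]
    (hu : ∀ a, ‖R.chi a‖ = 1) (hc : Continuous R.chi)
    (hχ : ∀ a ∈ localTorusAt W w, ∀ b ∈ localTorusAt W w,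
      weightAt W q w 0 (a * b) ^ eP w * weightAt W q w 1 (a * b) ^ eM w =
        (weightAt W q w 0 a ^ eP w * weightAt W q w 1 a ^ eM w) *
          (weightAt W q w 0 b ^ eP w * weightAt W q w 1 b ^ eM w))
    (hχc : Continuous fun κ : localTorusAt W w => weightAt W q w 0 κ ^ eP w * weightAt W q w 1 κ ^ eM w)
    (hu' : ∀ κ : localTorusAt W w, ‖weightAt W q w 0 κ ^ eP w * weightAt W q w 1 κ ^ eM w‖ = 1)
    (hmatch : ChiMatchesAt W q w (eP w) (eM w) R.chi)
    {U : Set (GA W → ℂ)} (hU : (Setting.ofAdelicData W R μ DG fdG compG compT compT').IsInvariantSubspace U)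
    (hcl : IsClosedSub (Setting.ofAdelicData W R μ DG fdG compG compT compT') U)
    {f : GA W → ℂ} (hf : f ∈ Submodule.span ℂ U)
    (hP : periodLin W R.μT R.DT R.chi (restrictTo W (torusT W) f) ≠ 0) :
    HasKTypeAt W q w (eP w) (eM w) (Submodule.span ℂ U) := by
  rcases U.eq_empty_or_nonempty with hU0 | hne
  · exfalso
    subst hU0
    rw [Submodule.span_empty, Submodule.mem_bot] at hf
    subst hf
    exact hP (by rw [show restrictTo W (torusT W) (0 : GA W → ℂ) = 0 from rfl, map_zero])
  · have hfU : f ∈ U := by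
      have h := coe_span_eq_of_isInvariantSubspace (Setting.ofAdelicData W R μ DG fdG compG compT compT') hU hne
      rw [← h]
      exact hf
    exact hasKTypeAt_of_period_ne_zero_closed W R μ DG fdG compG compT compT' w q eP eM ν hu hc hχ hχc hu' hmatch
      hU hcl hfU hP

/-- **The `span` form, primed** (`T′`-side). -/
theorem hasKTypeAt'_of_period_ne_zero_span (g g' : Matrix (Fin 4) (Fin 4) k) [R.μT'.IsMulRightInvariant]
    [CompactSpace (localTorusAt' W w)] (ν : Measure (localTorusAt' W w)) [ν.IsHaarMeasure] [IsProbabilityMeasure ν]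
    (hu : ∀ a, ‖R.chi' a‖ = 1) (hc : Continuous R.chi')
    (hχ : ∀ a ∈ localTorusAt' W w, ∀ b ∈ localTorusAt' W w,
      weightAt' W q w g g' 0 (a * b) ^ eP w * weightAt' W q w g g' 1 (a * b) ^ eM w =
        (weightAt' W q w g g' 0 a ^ eP w * weightAt' W q w g g' 1 a ^ eM w) *
          (weightAt' W q w g g' 0 b ^ eP w * weightAt' W q w g g' 1 b ^ eM w))
    (hχc : Continuous fun κ : localTorusAt' W w =>
      weightAt' W q w g g' 0 κ ^ eP w * weightAt' W q w g g' 1 κ ^ eM w)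
    (hu' : ∀ κ : localTorusAt' W w, ‖weightAt' W q w g g' 0 κ ^ eP w * weightAt' W q w g g' 1 κ ^ eM w‖ = 1)
    (hmatch : ChiMatchesAt' W q w g g' (eP w) (eM w) R.chi')
    {U : Set (GA W → ℂ)} (hU : (Setting.ofAdelicData W R μ DG fdG compG compT compT').IsInvariantSubspace U)
    (hcl : IsClosedSub (Setting.ofAdelicData W R μ DG fdG compG compT compT') U)
    {f : GA W → ℂ} (hf : f ∈ Submodule.span ℂ U)
    (hP : periodLin W R.μT' R.DT' R.chi' (restrictTo W (torusT' W) f) ≠ 0) :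
    HasKTypeAt' W q w g g' (eP w) (eM w) (Submodule.span ℂ U) := by
  rcases U.eq_empty_or_nonempty with hU0 | hne
  · exfalso
    subst hU0
    rw [Submodule.span_empty, Submodule.mem_bot] at hf
    subst hf
    exact hP (by rw [show restrictTo W (torusT' W) (0 : GA W → ℂ) = 0 from rfl, map_zero])
  · have hfU : f ∈ U := by
      have h := coe_span_eq_of_isInvariantSubspace (Setting.ofAdelicData W R μ DG fdG compG compT compT') hU hne
      rw [← h]
      exact hf
    exact hasKTypeAt'_of_period_ne_zero_closed W R μ DG fdG compG compT compT' w q eP eM g g' ν hu hc hχ hχc hu'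
      hmatch hU hcl hfU hP

end Closed

end Summit.Ventures.HodgeRepro.Tier4.Line4

end
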